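import Summits.QuantumFields.YangMills.Theorems.BalabanUVNodesN07H1OfRecordReality
import Summits.QuantumFields.YangMills.Theorems.BalabanUVNodesN07Delta2OfRecordUnique
import HarnessLib

/-!
# NODE N07 — THE (3.134) DATUM `Δ⁽²⁾` OF def-Y's SCHEME OF RECORD IS REAL, HENCE 3g′'s TOKEN `HessSymmTok Δ2` HOLDS FOR IT, AT EVERY GUARDED BACKGROUND —
# MODULO ONE DISPLAYED NONLINEAR LETTER: «`C⁽²⁾ = quadPart C^{𝔰𝔩}` commutes with `A ↦ Aᴴ`» ([B9] (3.134)–(3.135) p. 422, (3.124) p. 420; [15] (56), (78)–(79))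

Cell `pub-ymgap`, width seat `pub-ymgap-dag-n07-w3` (g26), CLAIM-4.  `--kind proof --supports stmt-QuantumFields-27238 --as helper`; count-neutral.
[B9] = [Balaban1985BackgroundPropagators]; [15] = [Balaban1985Variational].

THE ARGUMENT.  Let `Δ2` carry 3g′'s tokens `Delta2Tok ∧ Delta2SymmTok` (✓p820290: such a `Δ2` exists; ✓p820429: it is unique).  Its conjugate
`⋆Δ2⋆ = realConj (phiRec N) Δ2` carries them too: `Delta2SymmTok` because `⋆` is anti-unitary for the trace pairing (§1 `tpair_starW_right`), and `Delta2Tok`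
because every letter on the right of (3.134) is real — `J(U₀)` is Hermitian bondwise (def-Y ✓`star_JOfRecordAtBg_apply`), Sect. C's `H♭` is real (✓CLAIM-3
`equiv_H1OfRecordAtBgFlat_star`), and `C⁽²⁾(Aᴴ) = (C⁽²⁾A)ᴴ` — THE ONE HYPOTHESIS `hC2` OF THIS FILE (the exp∕log∕adjugate chart (44) commutes with `A ↦ Aᴴ` at an
`SU(N)` background; its kernel proof is the sequel).  By uniqueness `⋆Δ2⋆ = Δ2`, i.e. `Δ2` is real, and ✓`hessSymmTok_of_delta2SymmTok_of_starW_comm` concludes.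
* §1 `tpair_starW_right` (`(f, g⋆)_τ = conj (f⋆, g)_τ`), `pair27_star_right_of_herm` (`⟨K, δᴴ⟩₍₂₇₎ = conj ⟨K, δ⟩₍₂₇₎` for Hermitian `K`), `flat115_conj`, `funEquiv_symm_flat115_conj`.
* §2 ★`delta2SymmTok_realConj` (hypothesis-free), ★★`delta2Tok_realConj` (guard, `hQ`, `hpos♭` as carried by the letters; modulo `hC2`).
* §3 ★★★`realConj_eq_self_of_delta2Tok` (`Δ2` real), ★★★`hessSymmTok_of_delta2Tok` — 3g′'s third token for THE (3.134) datum, modulo `hC2` alone.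

HONEST LABELS.  Linear `*`-algebra over the tree's constructed pairing; the nonlinear reality letter `hC2` is DISPLAYED, not proved here; NO estimate; nothing of
`RegimeTok`∕`ChartSUTok`.  Count-neutral; N07 NOT discharged; P0 ⟨26900⟩ OPEN; R4 is the conditional finite-𝕋⁴ rung only.  Nothing here is a claim about the
Yang–Mills mass gap (`Summit.QuantumFields`): finite torus, fixed `ε`; nothing continuum ∕ OS ∕ Clay.
-/

set_option autoImplicit false

noncomputable section

open scoped Matrix Matrix.Norms.L2Operator InnerProductSpace ComplexConjugate BigOperators

namespace Summit.QuantumFields.YangMills.Theorems.N07Delta2OfRecordReal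

open Literature.MathematicalPhysics.QuantumFieldTheory.Balaban1983to89
open Literature.MathematicalPhysics.QuantumFieldTheory.Balaban1983to89.T4Continuum (T4Family)
open T4Continuum BlockAveraging
open B9SectCLatticeCarrier (Bond)
open B9Eq311L2Pairing (WL2)
open B9Eq311TracePairing (starW equiv_starW apply_equiv_starW starW_starW tpair tpair_comm tpair_eq_inner_starW realConj realConj_apply)
open B11Eq111FrakG (nabla115)
open B11Eq103H1Complex (BondL2K funEquiv)
open B11Eq115Space (NegSup NegSize levWeight JetSup)
open B11Eq90V0primeCurrent (flat115 flat115_apply)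
open B11Eq90Transpose (pair27 pair27_eq_sum)
open B9Eq3119DeltaPiCarrier (currentCLM)
open B11Eq80Current (quadPart)
open B9Eq3119DeltaPiReality (inner_starW_starW realConj_eq_self_iff)
open Node00
open Summit.QuantumFields.YangMills.Theorems.N07HessOpOfRecordSymmetric (tauRec_star tauRec_mul_comm)
open Summit.QuantumFields.YangMills.Theorems.N07Delta2OfRecordExists (pair27_currentCLM_eq_tpair)
open Summit.QuantumFields.YangMills.Theorems.N07Delta2OfRecordUnique (delta2SymmTok_iff_tpair_comm eq_of_delta2Tok_of_delta2SymmTok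
  hessSymmTok_of_delta2SymmTok_of_starW_comm)
open Summit.QuantumFields.YangMills.Theorems.N07H1OfRecordReality (funEquiv_symm_star equiv_H1OfRecordAtBgFlat_star)

variable (F : T4Family) (N : ℕ) (K : ℕ) (k : ℕ) (Ω : ℕ → Set (Site (F.P K) 0)) (U₀ : GaugeField (F.P K) 0 (SU N))

/-! ## §1  `⋆` against the two pairings -/

section Pairings

variable [Fact (0 < (F.L : ℝ))] [Fact (0 < (F.P K).eta k)] [Fact (0 < c0Rec F K k)]

omit [Fact (0 < (F.L : ℝ))] [Fact (0 < (F.P K).eta k)] in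
/-- **`(f, g⋆)_τ = conj (f⋆, g)_τ`** (`(f, g)_τ = ⟪f⋆, g⟫`, `⋆` anti-unitary). [cite: Balaban1985BackgroundPropagators, (3.11) p.392] -/
theorem tpair_starW_right (f g : BondL2K ℂ (F.P K).d (fun _ => (F.P K).sitesPerDir 0) (c0Rec F K k) (WRec N)) :
    tpair (phiRec N) (tauRec N) f (starW (phiRec N) g) = conj (tpair (phiRec N) (tauRec N) (starW (phiRec N) f) g) := by
  rw [tpair_eq_inner_starW (phiRec N) (tauRec N) inner_phiRec_symm, tpair_eq_inner_starW (phiRec N) (tauRec N) inner_phiRec_symm, starW_starW,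
    inner_starW_starW (phiRec N) (tauRec N) inner_phiRec_symm (tauRec_star N) (tauRec_mul_comm N)]

omit [Fact (0 < (F.L : ℝ))] [Fact (0 < (F.P K).eta k)] [Fact (0 < c0Rec F K k)] in
/-- **`⟨K, δᴴ⟩₍₂₇₎ = conj ⟨K, δ⟩₍₂₇₎` FOR A BONDWISE HERMITIAN CURRENT `K`** (`tr(Kδᴴ) = tr((δK)ᴴ) = conj tr(δK) = conj tr(Kδ)`).
[cite: Balaban1985Variational, (27) p.282; Balaban1985BackgroundPropagators, (3.11) p.392] -/
theorem pair27_star_right_of_herm {Kc : NegSizeLit F N K k Ω 3}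
    (hK : ∀ b, star (NegSup.equiv (levWeight (F.L : ℝ) ((F.P K).eta k) (bondLevLit F Ω k) 3) (Matrix (Fin N) (Fin N) ℂ) Kc b) =
      NegSup.equiv (levWeight (F.L : ℝ) ((F.P K).eta k) (bondLevLit F Ω k) 3) (Matrix (Fin N) (Fin N) ℂ) Kc b)
    (δ : Bond (F.P K).d (fun _ => (F.P K).sitesPerDir 0) → Matrix (Fin N) (Fin N) ℂ) :
    pair27 (tauRecCLM N) Kc (star δ) = conj (pair27 (tauRecCLM N) Kc δ) := by
  rw [pair27_eq_sum, pair27_eq_sum, map_mul, map_pow, Complex.conj_ofReal, map_sum]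
  congr 1
  refine Finset.sum_congr rfl fun b _ => ?_
  rw [tauRecCLM_apply, tauRecCLM_apply, Pi.star_apply, starRingEnd_apply, ← Matrix.trace_conjTranspose, Matrix.conjTranspose_mul,
    ← Matrix.star_eq_conjTranspose, ← Matrix.star_eq_conjTranspose, hK, Matrix.trace_mul_comm]

omit [Fact (0 < c0Rec F K k)] in
/-- The bondwise conjugate jet `Aᴴ` has underlying configuration `(♭A)ᴴ`. [cite: Balaban1985Variational, (115) p.294 (bookkeeping)] -/
theorem flat115_conj (A : Space115Lit F N K k Ω U₀) :
    flat115
        (((JetSup.equiv _ _ (nabla115 ((F.P K).eta k) (unitsOfRecord F N U₀))).symm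
            (star (JetSup.equiv _ _ (nabla115 ((F.P K).eta k) (unitsOfRecord F N U₀)) A)) : Space115Lit F N K k Ω U₀)) =
      star (flat115 A) := by
  simp only [flat115_apply, Equiv.apply_symm_apply]

omit [Fact (0 < c0Rec F K k)] in
/-- … read on the `L²` side: `(Aᴴ)^ = (Â)⋆`. [cite: Balaban1985Variational, (115) p.294; Balaban1985BackgroundPropagators, (3.11) p.392 (bookkeeping)] -/
theorem funEquiv_symm_flat115_conj (A : Space115Lit F N K k Ω U₀) :
    (funEquiv (phiRec N) (fun _ : Bond (F.P K).d (fun _ => (F.P K).sitesPerDir 0) => c0Rec F K k)).symm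
        (flat115
          (((JetSup.equiv _ _ (nabla115 ((F.P K).eta k) (unitsOfRecord F N U₀))).symm
              (star (JetSup.equiv _ _ (nabla115 ((F.P K).eta k) (unitsOfRecord F N U₀)) A)) : Space115Lit F N K k Ω U₀))) =
      starW (phiRec N) ((funEquiv (phiRec N) (fun _ : Bond (F.P K).d (fun _ => (F.P K).sitesPerDir 0) => c0Rec F K k)).symm (flat115 A)) := by
  rw [flat115_conj, funEquiv_symm_star]

end Pairings

/-! ## §2  `⋆Δ2⋆` carries both tokens -/

section Tokens

variable [NeZero N] [Fact (0 < (F.L : ℝ))] [Fact (0 < (F.P K).eta k)] [Fact (0 < c0Rec F K k)] [Fact (∀ c, 0 < wBRec F K k c)]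

omit [Fact (∀ c, 0 < wBRec F K k c)] in
/-- ★ **`Delta2SymmTok (⋆Δ2⋆) ⟸ Delta2SymmTok Δ2`**, hypothesis-free (`⋆` anti-unitary for the trace pairing). [cite: Balaban1985BackgroundPropagators, (3.134)–(3.135) p.422] -/
theorem delta2SymmTok_realConj
    {Δ2 : BondL2K ℂ (F.P K).d (fun _ => (F.P K).sitesPerDir 0) (c0Rec F K k) (WRec N) →ₗ[ℂ]
      BondL2K ℂ (F.P K).d (fun _ => (F.P K).sitesPerDir 0) (c0Rec F K k) (WRec N)}
    (hs : Delta2SymmTok F N K k Ω U₀ Δ2) : Delta2SymmTok F N K k Ω U₀ (realConj (phiRec N) Δ2) := by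
  rw [delta2SymmTok_iff_tpair_comm] at hs ⊢
  intro x y
  rw [realConj_apply, realConj_apply, tpair_starW_right, tpair_starW_right, hs]

variable (levB : PBond (F.P K) k → ℕ) (a : ℝ)
  (hposb : ∀ x, x ≠ 0 → 0 < RCLike.re ⟪x, laplaceAOfRecord F N k U₀ (QOfRecord F N k U₀) (QflatOfRecord F N k) a x⟫_ℂ)
  (hQ : Function.Surjective (QOfRecord F N k U₀))

/-- ★★ **`Delta2Tok (⋆Δ2⋆) ⟸ Delta2Tok Δ2`** at every guarded background, MODULO the displayed reality of `C⁽²⁾ = quadPart C^{𝔰𝔩}` (`hC2`): the right side of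
(3.134) conjugates like the left because `J(U₀)` is Hermitian (def-Y ✓`star_JOfRecordAtBg_apply`) and Sect. C's `H♭` is real (✓`equiv_H1OfRecordAtBgFlat_star`).
[cite: Balaban1985BackgroundPropagators, (3.134) p.422, (3.127)–(3.128) p.421; Balaban1985Variational, (27)–(28) p.282, (45) p.285, (56) p.286, (78)–(79) p.290] -/
theorem delta2Tok_realConj (h : SmallBelow (avOfRecord F N K) k U₀)
    (hC2 : ∀ A : Space115Lit F N K k Ω U₀,
      quadPart (CslOfRecord F N K k Ω U₀ levB)
          ((JetSup.equiv _ _ (nabla115 ((F.P K).eta k) (unitsOfRecord F N U₀))).symm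
            (star (JetSup.equiv _ _ (nabla115 ((F.P K).eta k) (unitsOfRecord F N U₀)) A))) =
        (NegSup.equiv _ _).symm (star (NegSup.equiv _ _ (quadPart (CslOfRecord F N K k Ω U₀ levB) A))))
    {Δ2 : BondL2K ℂ (F.P K).d (fun _ => (F.P K).sitesPerDir 0) (c0Rec F K k) (WRec N) →ₗ[ℂ]
      BondL2K ℂ (F.P K).d (fun _ => (F.P K).sitesPerDir 0) (c0Rec F K k) (WRec N)}
    (hΔ : Delta2Tok F N K k Ω U₀ levB a hposb hQ Δ2) : Delta2Tok F N K k Ω U₀ levB a hposb hQ (realConj (phiRec N) Δ2) := by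
  intro A
  -- abbreviations: the conjugate jet and the real scalar in front of the trace pairing
  set Ac : Space115Lit F N K k Ω U₀ := (JetSup.equiv _ _ (nabla115 ((F.P K).eta k) (unitsOfRecord F N U₀))).symm
    (star (JetSup.equiv _ _ (nabla115 ((F.P K).eta k) (unitsOfRecord F N U₀)) A)) with hAc
  have hκ : conj (((((F.P K).eta k : ℝ) : ℂ)) ^ (F.P K).d * (c0Rec F K k : ℂ)⁻¹) = ((((F.P K).eta k : ℝ) : ℂ)) ^ (F.P K).d * (c0Rec F K k : ℂ)⁻¹ := by
    rw [map_mul, map_pow, map_inv₀, Complex.conj_ofReal, Complex.conj_ofReal]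
  have hu := funEquiv_symm_flat115_conj F N K k Ω U₀ A
  rw [← hAc] at hu
  -- left side: `⟨(⋆Δ2⋆)^A, A⟩ = conj ⟨Δ2^ Aᴴ, Aᴴ⟩`
  have hL : pair27 (tauRecCLM N)
        (currentCLM (phiRec N) (pairLevLit F Ω k) (nabla115 ((F.P K).eta k) (unitsOfRecord F N U₀)) (realConj (phiRec N) Δ2) A) (flat115 A) =
      conj (pair27 (tauRecCLM N)
        (currentCLM (phiRec N) (pairLevLit F Ω k) (nabla115 ((F.P K).eta k) (unitsOfRecord F N U₀)) Δ2 Ac) (flat115 Ac)) := by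
    rw [pair27_currentCLM_eq_tpair, pair27_currentCLM_eq_tpair, map_mul, hκ, realConj_apply, hu,
      tpair_comm (phiRec N) (tauRec N) (tauRec_mul_comm N) (starW (phiRec N) _), tpair_starW_right,
      tpair_comm (phiRec N) (tauRec N) (tauRec_mul_comm N) (Δ2 _) (starW (phiRec N) _)]
  -- right side: `⟨J, ♭H♭C⁽²⁾(Aᴴ)⟩ = conj ⟨J, ♭H♭C⁽²⁾A⟩`
  have hflat : flat115 (H1OfRecordAtBgFlat F N K k Ω U₀ levB a hposb hQ (quadPart (CslOfRecord F N K k Ω U₀ levB) Ac)) =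
      star (flat115 (H1OfRecordAtBgFlat F N K k Ω U₀ levB a hposb hQ (quadPart (CslOfRecord F N K k Ω U₀ levB) A))) := by
    rw [hAc, hC2 A]
    simp only [flat115_apply]
    funext b
    rw [Pi.star_apply]
    exact equiv_H1OfRecordAtBgFlat_star F N k U₀ Ω levB h hposb hQ _ b
  have hR : pair27 (tauRecCLM N) (JOfRecordAtBg F N K k Ω U₀)
        (flat115 (H1OfRecordAtBgFlat F N K k Ω U₀ levB a hposb hQ (quadPart (CslOfRecord F N K k Ω U₀ levB) Ac))) =
      conj (pair27 (tauRecCLM N) (JOfRecordAtBg F N K k Ω U₀)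
        (flat115 (H1OfRecordAtBgFlat F N K k Ω U₀ levB a hposb hQ (quadPart (CslOfRecord F N K k Ω U₀ levB) A)))) := by
    rw [hflat, pair27_star_right_of_herm F N K k Ω star_JOfRecordAtBg_apply]
  rw [hL, hΔ Ac, hR, map_mul, map_neg, map_ofNat, Complex.conj_conj]

end Tokens

/-! ## §3  `Δ2` is real; `HessSymmTok Δ2` -/

section Real

variable [NeZero N] [Fact (0 < (F.L : ℝ))] [Fact (0 < (F.P K).eta k)] [Fact (0 < c0Rec F K k)] [Fact (∀ c, 0 < wBRec F K k c)]
  (levB : PBond (F.P K) k → ℕ) (a : ℝ)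
  (hposb : ∀ x, x ≠ 0 → 0 < RCLike.re ⟪x, laplaceAOfRecord F N k U₀ (QOfRecord F N k U₀) (QflatOfRecord F N k) a x⟫_ℂ)
  (hQ : Function.Surjective (QOfRecord F N k U₀))

/-- ★★★ **THE (3.134) DATUM IS REAL**: under the guard and modulo `hC2`, `⋆Δ2⋆ = Δ2` for every `Δ2` with `Delta2Tok ∧ Delta2SymmTok` (uniqueness ✓`eq_of_delta2Tok_of_delta2SymmTok`).
[cite: Balaban1985BackgroundPropagators, (3.134)–(3.135) p.422, p.392; Balaban1985Variational, (27) p.282, (78)–(79) p.290] -/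
theorem realConj_eq_self_of_delta2Tok (h : SmallBelow (avOfRecord F N K) k U₀)
    (hC2 : ∀ A : Space115Lit F N K k Ω U₀,
      quadPart (CslOfRecord F N K k Ω U₀ levB)
          ((JetSup.equiv _ _ (nabla115 ((F.P K).eta k) (unitsOfRecord F N U₀))).symm
            (star (JetSup.equiv _ _ (nabla115 ((F.P K).eta k) (unitsOfRecord F N U₀)) A))) =
        (NegSup.equiv _ _).symm (star (NegSup.equiv _ _ (quadPart (CslOfRecord F N K k Ω U₀ levB) A))))
    {Δ2 : BondL2K ℂ (F.P K).d (fun _ => (F.P K).sitesPerDir 0) (c0Rec F K k) (WRec N) →ₗ[ℂ]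
      BondL2K ℂ (F.P K).d (fun _ => (F.P K).sitesPerDir 0) (c0Rec F K k) (WRec N)}
    (hΔ : Delta2Tok F N K k Ω U₀ levB a hposb hQ Δ2) (hs : Delta2SymmTok F N K k Ω U₀ Δ2) : realConj (phiRec N) Δ2 = Δ2 :=
  eq_of_delta2Tok_of_delta2SymmTok F N K k Ω U₀ levB a hposb hQ (delta2Tok_realConj F N K k Ω U₀ levB a hposb hQ h hC2 hΔ)
    (delta2SymmTok_realConj F N K k Ω U₀ hs) hΔ hs

/-- ★★★ **3g′'s TOKEN `HessSymmTok Δ2` FOR THE (3.134) DATUM**, at every guarded background, modulo the one displayed nonlinear letter `hC2`: `Δ(U₀) + Δ⁽²⁾` is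
Hilbert-symmetric (reality + transpose-symmetry, ✓`hessSymmTok_of_delta2SymmTok_of_starW_comm`). [cite: Balaban1985BackgroundPropagators, (3.124) p.420, (3.128) p.421, (3.134)–(3.135) p.422] -/
theorem hessSymmTok_of_delta2Tok (h : SmallBelow (avOfRecord F N K) k U₀)
    (hC2 : ∀ A : Space115Lit F N K k Ω U₀,
      quadPart (CslOfRecord F N K k Ω U₀ levB)
          ((JetSup.equiv _ _ (nabla115 ((F.P K).eta k) (unitsOfRecord F N U₀))).symm
            (star (JetSup.equiv _ _ (nabla115 ((F.P K).eta k) (unitsOfRecord F N U₀)) A))) =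
        (NegSup.equiv _ _).symm (star (NegSup.equiv _ _ (quadPart (CslOfRecord F N K k Ω U₀ levB) A))))
    {Δ2 : BondL2K ℂ (F.P K).d (fun _ => (F.P K).sitesPerDir 0) (c0Rec F K k) (WRec N) →ₗ[ℂ]
      BondL2K ℂ (F.P K).d (fun _ => (F.P K).sitesPerDir 0) (c0Rec F K k) (WRec N)}
    (hΔ : Delta2Tok F N K k Ω U₀ levB a hposb hQ Δ2) (hs : Delta2SymmTok F N K k Ω U₀ Δ2) : HessSymmTok F N K k U₀ Δ2 :=
  hessSymmTok_of_delta2SymmTok_of_starW_comm F N K k Ω U₀ hs fun x =>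
    ((realConj_eq_self_iff (phiRec N) Δ2).1 (realConj_eq_self_of_delta2Tok F N K k Ω U₀ levB a hposb hQ h hC2 hΔ hs) x).symm

end Real

end Summit.QuantumFields.YangMills.Theorems.N07Delta2OfRecordReal

end
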